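import Summits.HubbardSuperconductivity.HubbardSuperconductivity.Theorems.AnisotropyChordTransferFibre3Lam2LogBound
import Summits.HubbardSuperconductivity.HubbardSuperconductivity.Theorems.AnisotropyChordTransferFibre3LatticeSums
import Summits.HubbardSuperconductivity.HubbardSuperconductivity.Theorems.AnisotropyChordTransferFibre3LatticeEnergy

/-!
# Route `AnisotropyChord` / H0 rotor rung: the LOGARITHMIC a-priori bound on the ground two-magnon eigenvalue, II — `G̃₀(0) ≥ H_N/π²`, `η_eff ≤ π²/(4H_N)`

Continuation of `…Fibre3Lam2LogBound` (`η_eff ≤ 1/(4G̃₀(0))`): an explicit ∀L lower bound on the zero-mode-removed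
Green's function at the origin, `G̃₀(0) = (1/V)Σ_{k≠0} 1/(2ε(k))`:
* `sum_inv_normSq_ge_harmonic`: `Σ_{0<|m|∞≤N} 1/|m|² ≥ 4 H_N` (ring count from below: `8n` points with `|m|² ≤ 2n²`;
  the companion of p2's upper count `RateLemma.sum_inv_normSq_le_harmonic`);
* ★ `Gres_zero_zero_ge_box`: `G̃₀(0) ≥ (1/4π²)·Σ_{0<|m|∞≤N} 1/|m|²` for `2N + 1 ≤ L` (sub-box injection `m ↦ (m̄₁, m̄₂)`
  via `ZMod.valMinAbs_spec`, `2(1 − cos x) ≤ x²` on the representatives, `epsT_eq_wInt`);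
* ★ `Gres_zero_zero_ge_harmonic`: `G̃₀(0) ≥ H_{(L−1)/2}/π²`;
* ★★ `etaEff_le_harmonic`: **`η_eff ≤ π²/(4·H_{(L−1)/2})`**, `lam2_le_harmonic`: `λ₂ ≤ π²/(V·H_{(L−1)/2})`, `etaEff_le_log`:
  `η_eff ≤ π²/(4 log(L/2))` for the ground profile (`3 ≤ L`, `0 ≤ Δ`) — an a-priori `ν`-range `ν = η_eff/π² ≤ 1/(4H_N)` for
  the Level-2 cells (`ν ≤ .0754` at `L = 32`, `≤ .0461` at `L = 256`).
Prover seat `hubbard-h0-rotor-p1` g24; helper for stmt-HubbardSuperconductivity-19089 (`--supports`).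
-/

set_option linter.dupNamespace false
set_option autoImplicit false

noncomputable section

open scoped BigOperators
open Complex

namespace Summit.HubbardSuperconductivity.HubbardSuperconductivity.Theorems.AnisotropyChord.Transfer.Fibre3

variable (L : ℕ) [NeZero L]

/-! ## An explicit lower bound on `G̃₀(0)`: the sub-box injection -/

open RateLemma in
/-- the ring count from below: `Σ_{0<|m|∞≤N} 1/|m|² ≥ 4·H_N` (`8n` points on the ring `|m|∞ = n`, each with `|m|² ≤ 2n²`). [folklore] -/
theorem sum_inv_normSq_ge_harmonic (N : ℕ) :
    4 * (harmonic N : ℝ) ≤ ∑ m ∈ puncturedBox N, 1 / (((m.1 ^ 2 + m.2 ^ 2 : ℤ)) : ℝ) := by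
  induction N with
  | zero =>
    have : puncturedBox 0 = ∅ := by decide
    simp [this]
  | succ N ih =>
    rw [← Finset.sum_sdiff (puncturedBox_mono N), harmonic_succ, Rat.cast_add, Rat.cast_inv, Rat.cast_natCast,
      Nat.cast_succ]
    have hring : 4 / ((N : ℝ) + 1) ≤ ∑ m ∈ puncturedBox (N + 1) \ puncturedBox N, 1 / (((m.1 ^ 2 + m.2 ^ 2 : ℤ)) : ℝ) := by
      have hN1 : (0 : ℝ) < (N : ℝ) + 1 := by positivity
      have hle : ∀ m ∈ puncturedBox (N + 1) \ puncturedBox N,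
          1 / (2 * ((N : ℝ) + 1) ^ 2) ≤ 1 / (((m.1 ^ 2 + m.2 ^ 2 : ℤ)) : ℝ) := by
        intro m hm
        have hlow := ring_normSq_ge N m hm
        rw [Finset.mem_sdiff, mem_puncturedBox] at hm
        obtain ⟨⟨_, ⟨h1, h2⟩, ⟨h3, h4⟩⟩, _⟩ := hm
        push_cast at h1 h2 h3 h4
        have hup : (((m.1 ^ 2 + m.2 ^ 2 : ℤ)) : ℝ) ≤ 2 * ((N : ℝ) + 1) ^ 2 := by
          have k1 : m.1 ^ 2 ≤ ((N : ℤ) + 1) ^ 2 := by nlinarith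
          have k2 : m.2 ^ 2 ≤ ((N : ℤ) + 1) ^ 2 := by nlinarith
          have : ((m.1 ^ 2 + m.2 ^ 2 : ℤ)) ≤ 2 * ((N : ℤ) + 1) ^ 2 := by nlinarith
          exact_mod_cast this
        exact one_div_le_one_div_of_le (lt_of_lt_of_le (by positivity) hlow) hup
      have hcard : ((puncturedBox (N + 1) \ puncturedBox N).card : ℝ) = 8 * ((N : ℝ) + 1) := by
        rw [Finset.card_sdiff_of_subset (puncturedBox_mono N), card_puncturedBox, card_puncturedBox,
          show 4 * (N + 1) * (N + 1 + 1) = 8 * (N + 1) + 4 * N * (N + 1) by ring, Nat.add_sub_cancel]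
        push_cast
        ring
      have h := Finset.card_nsmul_le_sum _ _ _ hle
      rw [nsmul_eq_mul, hcard] at h
      calc 4 / ((N : ℝ) + 1) = 8 * ((N : ℝ) + 1) * (1 / (2 * ((N : ℝ) + 1) ^ 2)) := by field_simp; ring
        _ ≤ _ := h
    have : 4 / ((N : ℝ) + 1) = 4 * ((N : ℝ) + 1)⁻¹ := by rw [div_eq_mul_inv]
    linarith [hring, ih]

/-- the canonical representative of a small integer: `valMinAbs (m̄) = m` for `2|m| + 1 ≤ L`. [folklore] -/
theorem valMinAbs_intCast_of_small {m : ℤ} (hm : 2 * |m| + 1 ≤ (L : ℤ)) : ((m : ZMod L)).valMinAbs = m := by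
  rw [ZMod.valMinAbs_spec]
  refine ⟨rfl, ?_, ?_⟩
  · have := neg_abs_le m; linarith
  · have := le_abs_self m; linarith

omit [NeZero L] in
/-- `2(1 − cos x) ≤ x²`, in the form `wInt m ≤ (2πm/L)²/2`. [folklore] -/
theorem wInt_le_sq (m : ℤ) : wInt L m ≤ (2 * Real.pi * (m : ℝ) / L) ^ 2 / 2 := by
  unfold wInt
  have := Real.one_sub_sq_div_two_le_cos (x := 2 * Real.pi * (m : ℝ) / L)
  linarith

open RateLemma in
/-- ★ **the sub-box bound:** `G̃₀(0) ≥ (1/4π²)·Σ_{0<|m|∞≤N} 1/|m|²` whenever `2N + 1 ≤ L` (every box point is a distinct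
nonzero momentum `k = (m̄₁, m̄₂)` with `2ε(k) ≤ θ²|m|²`). [folklore] -/
theorem Gres_zero_zero_ge_box (hL : 2 ≤ L) (N : ℕ) (hN : 2 * N + 1 ≤ L) :
    (1 / (4 * Real.pi ^ 2)) * ∑ m ∈ puncturedBox N, 1 / (((m.1 ^ 2 + m.2 ^ 2 : ℤ)) : ℝ) ≤ Gres L 0 0 := by
  have hLpos : (0 : ℝ) < L := by exact_mod_cast Nat.pos_of_ne_zero (NeZero.ne L)
  have hV : (0 : ℝ) < (L : ℝ) ^ 2 := by positivity
  have hπ := Real.pi_pos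
  -- the injection
  set ι : ℤ × ℤ → Tor L := fun m => (((m.1 : ZMod L)), ((m.2 : ZMod L))) with hι
  have hsmall : ∀ m ∈ puncturedBox N, 2 * |m.1| + 1 ≤ (L : ℤ) ∧ 2 * |m.2| + 1 ≤ (L : ℤ) := by
    intro m hm
    rw [mem_puncturedBox] at hm
    obtain ⟨_, ⟨h1, h2⟩, ⟨h3, h4⟩⟩ := hm
    have hN' : 2 * (N : ℤ) + 1 ≤ (L : ℤ) := by exact_mod_cast hN
    constructor
    · have : |m.1| ≤ N := abs_le.mpr ⟨h1, h2⟩; linarith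
    · have : |m.2| ≤ N := abs_le.mpr ⟨h3, h4⟩; linarith
  have hrep : ∀ m ∈ puncturedBox N, (ι m).1.valMinAbs = m.1 ∧ (ι m).2.valMinAbs = m.2 := by
    intro m hm
    obtain ⟨a, b⟩ := hsmall m hm
    exact ⟨valMinAbs_intCast_of_small L a, valMinAbs_intCast_of_small L b⟩
  have hinj : Set.InjOn ι (puncturedBox N : Set (ℤ × ℤ)) := by
    intro m hm m' hm' h
    obtain ⟨a, b⟩ := hrep m hm
    obtain ⟨a', b'⟩ := hrep m' hm'
    have e1 : m.1 = m'.1 := by rw [← a, ← a', h]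
    have e2 : m.2 = m'.2 := by rw [← b, ← b', h]
    exact Prod.ext e1 e2
  have hne : ∀ m ∈ puncturedBox N, ι m ≠ 0 := by
    intro m hm h0
    obtain ⟨a, b⟩ := hrep m hm
    have h1 : m.1 = 0 := by rw [← a, h0]; exact ZMod.valMinAbs_zero L
    have h2 : m.2 = 0 := by rw [← b, h0]; exact ZMod.valMinAbs_zero L
    rw [mem_puncturedBox] at hm
    exact hm.1 (Prod.ext h1 h2)
  -- termwise comparison
  have hterm : ∀ m ∈ puncturedBox N,
      (L : ℝ) ^ 2 / (4 * Real.pi ^ 2) * (1 / (((m.1 ^ 2 + m.2 ^ 2 : ℤ)) : ℝ)) ≤ gres L 0 (ι m) := by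
    intro m hm
    obtain ⟨a, b⟩ := hrep m hm
    have hk := hne m hm
    unfold gres
    rw [if_neg hk, sub_zero]
    have hεpos : 0 < 2 * epsT L (ι m) := by
      have h1 := eps1_le_epsT L hL hk
      have h2 := RateLemma.eps1_pos_of_two_le L hL
      linarith
    have hεle : 2 * epsT L (ι m) ≤ (2 * Real.pi / L) ^ 2 * (((m.1 ^ 2 + m.2 ^ 2 : ℤ)) : ℝ) := by
      rw [epsT_eq_wInt, a, b]
      have w1 := wInt_le_sq L m.1
      have w2 := wInt_le_sq L m.2
      push_cast
      have e : (2 * Real.pi / L) ^ 2 * ((m.1 : ℝ) ^ 2 + (m.2 : ℝ) ^ 2)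
          = 2 * ((2 * Real.pi * (m.1 : ℝ) / L) ^ 2 / 2) + 2 * ((2 * Real.pi * (m.2 : ℝ) / L) ^ 2 / 2) := by ring
      rw [e]; linarith
    have hm0 : (0 : ℝ) < (((m.1 ^ 2 + m.2 ^ 2 : ℤ)) : ℝ) := by
      have : (ι m) ≠ 0 := hk
      have hz : m ≠ (0, 0) := by rw [mem_puncturedBox] at hm; exact hm.1
      have : 0 < m.1 ^ 2 + m.2 ^ 2 := by
        by_contra hc
        have hc' : m.1 ^ 2 + m.2 ^ 2 ≤ 0 := le_of_not_gt hc
        have h1 : m.1 = 0 := by nlinarith [sq_nonneg m.1, sq_nonneg m.2]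
        have h2 : m.2 = 0 := by nlinarith [sq_nonneg m.1, sq_nonneg m.2]
        exact hz (Prod.ext h1 h2)
      exact_mod_cast this
    have key := one_div_le_one_div_of_le hεpos hεle
    calc (L : ℝ) ^ 2 / (4 * Real.pi ^ 2) * (1 / (((m.1 ^ 2 + m.2 ^ 2 : ℤ)) : ℝ))
        = 1 / ((2 * Real.pi / L) ^ 2 * (((m.1 ^ 2 + m.2 ^ 2 : ℤ)) : ℝ)) := by
          field_simp
          norm_num
      _ ≤ 1 / (2 * epsT L (ι m)) := key
  -- assemble
  rw [Gres_zero_eq, le_div_iff₀ hV]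
  calc 1 / (4 * Real.pi ^ 2) * (∑ m ∈ puncturedBox N, 1 / (((m.1 ^ 2 + m.2 ^ 2 : ℤ)) : ℝ)) * (L : ℝ) ^ 2
      = ∑ m ∈ puncturedBox N, (L : ℝ) ^ 2 / (4 * Real.pi ^ 2) * (1 / (((m.1 ^ 2 + m.2 ^ 2 : ℤ)) : ℝ)) := by
        rw [Finset.mul_sum]
        rw [Finset.sum_mul]
        refine Finset.sum_congr rfl fun m _ => ?_
        ring
    _ ≤ ∑ m ∈ puncturedBox N, gres L 0 (ι m) := Finset.sum_le_sum hterm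
    _ = ∑ k ∈ (puncturedBox N).image ι, gres L 0 k := (Finset.sum_image hinj).symm
    _ ≤ ∑ k : Tor L, gres L 0 k :=
        Finset.sum_le_sum_of_subset_of_nonneg (Finset.subset_univ _) fun k _ _ => gres_zero_nonneg L hL k

/-- ★ **`G̃₀(0) ≥ H_N/π²`** with `N = (L − 1)/2`, every `L ≥ 2`. [folklore] -/
theorem Gres_zero_zero_ge_harmonic (hL : 2 ≤ L) :
    (harmonic ((L - 1) / 2) : ℝ) / Real.pi ^ 2 ≤ Gres L 0 0 := by
  have hN : 2 * ((L - 1) / 2) + 1 ≤ L := by omega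
  have h1 := Gres_zero_zero_ge_box L hL ((L - 1) / 2) hN
  have h2 := sum_inv_normSq_ge_harmonic ((L - 1) / 2)
  have hπ : 0 < Real.pi ^ 2 := by positivity
  calc (harmonic ((L - 1) / 2) : ℝ) / Real.pi ^ 2
      = (1 / (4 * Real.pi ^ 2)) * (4 * (harmonic ((L - 1) / 2) : ℝ)) := by field_simp
    _ ≤ (1 / (4 * Real.pi ^ 2)) * ∑ m ∈ RateLemma.puncturedBox ((L - 1) / 2), 1 / (((m.1 ^ 2 + m.2 ^ 2 : ℤ)) : ℝ) :=
        mul_le_mul_of_nonneg_left h2 (by positivity)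
    _ ≤ Gres L 0 0 := h1

omit [NeZero L] in
/-- `H_N > 0` for the half-width `N = (L−1)/2 ≥ 1`, i.e. `L ≥ 3`. [folklore] -/
theorem harmonic_half_pos (hL : 3 ≤ L) : (0 : ℝ) < (harmonic ((L - 1) / 2) : ℝ) := by
  have hN : 1 ≤ (L - 1) / 2 := by omega
  obtain ⟨n, hn⟩ : ∃ n, (L - 1) / 2 = n + 1 := ⟨(L - 1) / 2 - 1, by omega⟩
  rw [hn, harmonic_succ]
  push_cast
  have h0 : (0 : ℝ) ≤ (harmonic n : ℝ) := by
    have : (0 : ℚ) ≤ harmonic n := by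
      unfold harmonic; exact Finset.sum_nonneg fun i _ => by positivity
    exact_mod_cast this
  positivity

/-! ## The a-priori `ν`-range: `η_eff ≤ π²/(4 H_{(L−1)/2})` -/

/-- ★★ **`η_eff ≤ π²/(4·H_{(L−1)/2})`** for the ground two-magnon profile (`L ≥ 3`, `0 ≤ Δ`): the a-priori range of the
Level-2 variable `ν = η_eff/π² ≤ 1/(4 H_N)` (e.g. `ν ≤ .0754` at `L = 32`, `≤ .0461` at `L = 256`). [folklore] -/
theorem etaEff_le_harmonic (hL : 3 ≤ L) {Δ lam2 : ℝ} (hΔ : 0 ≤ Δ) {f : Tor L → ℝ} (hf : IsGroundTwoMagnon L Δ lam2 f) :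
    etaEff L lam2 ≤ Real.pi ^ 2 / (4 * (harmonic ((L - 1) / 2) : ℝ)) := by
  have h1 := etaEff_le_inv_Gres L hL hΔ hf
  have h2 := Gres_zero_zero_ge_harmonic L (by omega)
  have hH := harmonic_half_pos L hL
  have hπ : 0 < Real.pi ^ 2 := by positivity
  have hG := Gres_zero_zero_pos L (by omega)
  calc etaEff L lam2 ≤ 1 / (4 * Gres L 0 0) := h1
    _ ≤ 1 / (4 * ((harmonic ((L - 1) / 2) : ℝ) / Real.pi ^ 2)) :=
        one_div_le_one_div_of_le (by positivity) (by linarith)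
    _ = Real.pi ^ 2 / (4 * (harmonic ((L - 1) / 2) : ℝ)) := by field_simp

/-- ★★ **`λ₂ ≤ π²/(V·H_{(L−1)/2})`** for the ground two-magnon profile (`L ≥ 3`, `0 ≤ Δ`). [folklore] -/
theorem lam2_le_harmonic (hL : 3 ≤ L) {Δ lam2 : ℝ} (hΔ : 0 ≤ Δ) {f : Tor L → ℝ} (hf : IsGroundTwoMagnon L Δ lam2 f) :
    lam2 ≤ Real.pi ^ 2 / ((L : ℝ) ^ 2 * (harmonic ((L - 1) / 2) : ℝ)) := by
  have h := etaEff_le_harmonic L hL hΔ hf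
  have hH := harmonic_half_pos L hL
  have hV : (0 : ℝ) < (L : ℝ) ^ 2 := by
    have : (0 : ℝ) < L := by exact_mod_cast Nat.pos_of_ne_zero (NeZero.ne L)
    positivity
  unfold etaEff at h
  rw [div_le_div_iff₀ (by norm_num) (by positivity)] at h
  rw [le_div_iff₀ (by positivity)]
  nlinarith

/-- the logarithmic form: `η_eff ≤ π²/(4·log((L+1)/2))`, `L ≥ 3`, `0 ≤ Δ` (`H_N ≥ log(N+1)`, `N + 1 ≥ (L+1)/2 − 1/2`;
stated with `log(L/2) ≤ log(N+1)`). [folklore] -/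
theorem etaEff_le_log (hL : 3 ≤ L) {Δ lam2 : ℝ} (hΔ : 0 ≤ Δ) {f : Tor L → ℝ} (hf : IsGroundTwoMagnon L Δ lam2 f) :
    etaEff L lam2 ≤ Real.pi ^ 2 / (4 * Real.log ((L : ℝ) / 2)) := by
  have h := etaEff_le_harmonic L hL hΔ hf
  have hlogH := log_add_one_le_harmonic ((L - 1) / 2)
  push_cast at hlogH
  have hL3 : (3 : ℝ) ≤ L := by exact_mod_cast hL
  have hlog_pos : 0 < Real.log ((L : ℝ) / 2) := Real.log_pos (by linarith)
  have hmono : Real.log ((L : ℝ) / 2) ≤ Real.log ((((L - 1) / 2 : ℕ) : ℝ) + 1) := by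
    apply Real.log_le_log (by linarith)
    have h1 : 2 * ((L - 1) / 2) + 2 ≥ L := by omega
    have h2 : (2 : ℝ) * ((((L - 1) / 2 : ℕ) : ℝ)) + 2 ≥ (L : ℝ) := by exact_mod_cast h1
    linarith
  have hπ : 0 < Real.pi ^ 2 := by positivity
  calc etaEff L lam2 ≤ Real.pi ^ 2 / (4 * (harmonic ((L - 1) / 2) : ℝ)) := h
    _ ≤ Real.pi ^ 2 / (4 * Real.log ((L : ℝ) / 2)) := by
        apply div_le_div_of_nonneg_left hπ.le (by positivity)
        linarith

end Summit.HubbardSuperconductivity.HubbardSuperconductivity.Theorems.AnisotropyChord.Transfer.Fibre3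

end
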